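import Summits.Ventures.PackingBounds.Configurations.P15aCount
import Summits.Ventures.PackingBounds.Configurations.CL18Pairs

/-!
# The local arrangement `P₁₅ₐ`, II: `κ(15) ≥ 2564` in Lean

Framing: lottery ticket; floor = certified bounds/negative ranges. Venture `PackingBounds` (cell
`pub-packcert`, seat `pub-packcert-energy`).

The `2564` integer vectors `p15a ⊂ ℤ²⁴` (`P15aCount.lean`; scale `2`, norm `16`) have pairwise inner products `≤ 8`:
central pairs by Construction A (`KissingConstructionA.lean`), layers by the minimum distance `4` of the
`[14,9,4]` code and the weight `≥ 2` of its coset by `(1,1,0¹²)`, the rest by the sizes of the supports. They lie in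
the `15`-dimensional subspace `{y₁₄ = y₁₅ = 0, y₁₆ = y₁₇, y₁₈ = ⋯ = y₂₃ = 0}` of `ℝ²⁴` (nine integer normals, checked by
`decide`). Transfer (`Config.exists_transfer_orthogonal`) gives **a kissing configuration of `2564` unit vectors in
`ℝ¹⁵`**: `κ(15) ≥ 2564` (Leech–Sloane 1971; SPLAG Table 1.2 — the record lower bound in dimension `15` at the time of
writing), as a kernel-checked theorem (`exists_kissing_2564`); with the cell's LP certificate `2564 ≤ κ(15) ≤ 5431`.

## References
* J. H. Conway, N. J. A. Sloane, *Sphere Packings, Lattices and Groups*, Ch. 5 §4.3 and Table 1.2. [`ConwaySloane1999`]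
-/

namespace Summit.Ventures.PackingBounds.Config.ConsA

open Finset Leech Golay CL17

attribute [local irreducible] consA blockVecs pointVecs

/-! ### Uniform presentation and norms -/

/-- A cell `< 14` set is a cell set. -/
theorem sub_cells_of_lt14 {S : Finset (Fin 24)} (hS : ∀ j ∈ S, j.val < 14) : S ⊆ cells :=
  fun j hj => mem_cells.mpr (by have := hS j hj; omega)

/-- The pair `{2i, 2i+1}` consists of cells `< 14`. -/
theorem pair_lt14 (i : Fin 7) :
    ∀ j ∈ ({(⟨2 * i.val, by omega⟩ : Fin 24), ⟨2 * i.val + 1, by omega⟩} : Finset (Fin 24)), j.val < 14 := by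
  intro j hj
  rw [Finset.mem_insert, Finset.mem_singleton] at hj
  rcases hj with rfl | rfl <;> (simp; omega)

/-- `cells14` consists of cells `< 14`. -/
theorem cells14_lt : ∀ j ∈ cells14, j.val < 14 := fun j hj => by rw [cells14, mem_filter] at hj; exact hj.2

/-- Every vector of `P₁₅ₐ` is a multiple of a pattern vector on cells `< 14`, and has norm `16`. -/
theorem exists_pvec_of_mem_p15a {x : Fin 24 → ℤ} (hx : x ∈ p15a) : ∃ c : ℤ, ∃ S : Finset (Fin 24),
    ∃ f : Fin 24 → Bool, ∃ a e : ℤ, (∀ j ∈ S, j.val < 14) ∧ x = c • pvec S f a e ∧ ip x x = 16 := by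
  rw [p15a, mem_union, mem_union, mem_union] at hx
  rcases hx with ((hx | hx) | hx) | hx
  · obtain ⟨y, -, rfl, S, f, a, hS, rfl, ha⟩ := central_props hx
    refine ⟨2, S, f, a, 0, hS, rfl, ?_⟩
    rw [ip_two_smul, ip_pvec_self (sub_cells_of_lt14 hS)]
    rcases ha with ⟨rfl, h⟩ | ⟨rfl, h⟩ <;> rw [h] <;> norm_num
  · rw [layerM] at hx
    obtain ⟨m, -, rfl⟩ := mem_image.mp hx
    refine ⟨1, _, _, _, _, cells14_lt, by rw [one_smul]; rfl, ?_⟩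
    rw [ip_lvec, Nat.xor_self]; simp
  · rw [layerP] at hx
    obtain ⟨m, -, rfl⟩ := mem_image.mp hx
    refine ⟨1, _, _, _, _, cells14_lt, by rw [one_smul]; rfl, ?_⟩
    rw [ip_lvec, Nat.xor_self]; simp
  · rw [outer] at hx
    obtain ⟨⟨i, a, b, t⟩, -, rfl⟩ := mem_image.mp hx
    refine ⟨1, _, _, _, _, pair_lt14 i, by rw [one_smul], ?_⟩
    rw [ip_pvec_self (sub_cells_of_lt14 (pair_lt14 i)), card_pair (by simp)]
    rcases sgn_cases t with h | h <;> rw [h] <;> norm_num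

/-! ### Pairwise inner products -/

/-- Members of the lower layer. -/
theorem mem_layerM {x : Fin 24 → ℤ} (hx : x ∈ layerM) : ∃ m < 512, x = lvec (ham14 m) (-1) := by
  rw [layerM] at hx
  obtain ⟨m, hm, rfl⟩ := mem_image.mp hx
  exact ⟨m, mem_range.mp hm, rfl⟩

/-- Members of the upper layer. -/
theorem mem_layerP {x : Fin 24 → ℤ} (hx : x ∈ layerP) : ∃ m < 512, x = lvec (ham14 m ^^^ 3) 1 := by
  rw [layerP] at hx
  obtain ⟨m, hm, rfl⟩ := mem_image.mp hx
  exact ⟨m, mem_range.mp hm, rfl⟩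

/-- A Construction-A vector against a layer vector: `≤ 4`. -/
theorem ip_consA_lvec {y : Fin 24 → ℤ} {S : Finset (Fin 24)} {f : Fin 24 → Bool} {a : ℤ}
    (hS : ∀ j ∈ S, j.val < 14) (hy : y = pvec S f a 0) (ha : (a = 1 ∧ S.card = 4) ∨ (a = 2 ∧ S.card = 1))
    (c : ℕ) (e : ℤ) : ip y (lvec c e) ≤ 4 := by
  subst hy
  have hpos : (0 : ℤ) ≤ a * 1 := by rcases ha with ⟨rfl, -⟩ | ⟨rfl, -⟩ <;> norm_num
  have h := ip_pvec_pvec_le_inter (sub_cells_of_lt14 hS) cells14_sub f (fun j => c.testBit j.val) hpos 0 e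
  have hle : ((S ∩ cells14).card : ℤ) ≤ S.card := by exact_mod_cast card_le_card inter_subset_left
  rw [lvec]
  rcases ha with ⟨rfl, h4⟩ | ⟨rfl, h1⟩
  · rw [h4] at hle; push_cast at hle h ⊢; linarith
  · rw [h1] at hle; push_cast at hle h ⊢; linarith

/-- A Construction-A vector against an outer vector: `≤ 4`. -/
theorem ip_consA_outer {y : Fin 24 → ℤ} {S : Finset (Fin 24)} {f : Fin 24 → Bool} {a : ℤ}
    (hS : ∀ j ∈ S, j.val < 14) (hy : y = pvec S f a 0) (ha : (a = 1 ∧ S.card = 4) ∨ (a = 2 ∧ S.card = 1))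
    (i : Fin 7) (g : Fin 24 → Bool) (t : ℤ) :
    ip y (pvec {(⟨2 * i.val, by omega⟩ : Fin 24), ⟨2 * i.val + 1, by omega⟩} g 2 t) ≤ 4 := by
  subst hy
  have hpos : (0 : ℤ) ≤ a * 2 := by rcases ha with ⟨rfl, -⟩ | ⟨rfl, -⟩ <;> norm_num
  have h := ip_pvec_pvec_le_inter (sub_cells_of_lt14 hS) (sub_cells_of_lt14 (pair_lt14 i)) f g hpos 0 t
  have hle1 : ((S ∩ {(⟨2 * i.val, by omega⟩ : Fin 24), ⟨2 * i.val + 1, by omega⟩}).card : ℤ) ≤ S.card := by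
    exact_mod_cast card_le_card inter_subset_left
  have hle2 : ((S ∩ {(⟨2 * i.val, by omega⟩ : Fin 24), ⟨2 * i.val + 1, by omega⟩}).card : ℤ) ≤ 2 := by
    exact_mod_cast (card_le_card inter_subset_right).trans (by rw [card_pair (by simp)])
  rcases ha with ⟨rfl, -⟩ | ⟨rfl, h1⟩
  · push_cast at h hle2 ⊢; linarith
  · rw [h1] at hle1; push_cast at h hle1 ⊢; linarith

/-- Central against anything else: `≤ 8`. -/
theorem ip_central_le {x z : Fin 24 → ℤ} (hx : x ∈ central) (hz : z ∈ layerM ∨ z ∈ layerP ∨ z ∈ outer) :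
    ip x z ≤ 8 := by
  obtain ⟨y, -, rfl, S, f, a, hS, hy, ha⟩ := central_props hx
  have h2 : ip ((2 : ℤ) • y) z = 2 * ip y z := by
    simp only [ip, Pi.smul_apply, smul_eq_mul, Finset.mul_sum]
    exact Finset.sum_congr rfl fun j _ => by ring
  rw [h2]
  rcases hz with hz | hz | hz
  · obtain ⟨m, -, rfl⟩ := mem_layerM hz
    linarith [ip_consA_lvec hS hy ha (ham14 m) (-1)]
  · obtain ⟨m, -, rfl⟩ := mem_layerP hz
    linarith [ip_consA_lvec hS hy ha (ham14 m ^^^ 3) 1]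
  · rw [outer] at hz
    obtain ⟨⟨i, a', b, t⟩, -, rfl⟩ := mem_image.mp hz
    linarith [ip_consA_outer hS hy ha i (fun j => if j.val = 2 * i.val then a' else b) (2 * sgn t)]

/-- Central against central: `4 · 2 = 8`. -/
theorem ip_central_central {x x' : Fin 24 → ℤ} (hx : x ∈ central) (hx' : x' ∈ central) (hne : x ≠ x') :
    ip x x' ≤ 8 := by
  obtain ⟨y, hy, rfl, -⟩ := central_props hx
  obtain ⟨y', hy', rfl, -⟩ := central_props hx'
  rw [ip_two_smul]
  have := ip_le_of_mem_consA p14a_hyp.1 p14a_hyp.2.1 p14a_hyp.2.2 hy hy' (fun h => hne (by rw [h]))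
  linarith

/-- Layer against layer: `≤ 8` (minimum distance `4`; coset weight `≥ 2` across). -/
theorem ip_layer_layer {x x' : Fin 24 → ℤ} (hx : x ∈ layerM ∨ x ∈ layerP) (hx' : x' ∈ layerM ∨ x' ∈ layerP)
    (hne : x ≠ x') : ip x x' ≤ 8 := by
  rcases hx with hx | hx <;> rcases hx' with hx' | hx'
  · obtain ⟨m, hm, rfl⟩ := mem_layerM hx
    obtain ⟨m', hm', rfl⟩ := mem_layerM hx'
    have hmm : m ≠ m' := fun h => hne (by rw [h])
    have := four_le_card_diff hm hm' hmm
    rw [ip_lvec]; push_cast; omega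
  · obtain ⟨m, hm, rfl⟩ := mem_layerM hx
    obtain ⟨m', hm', rfl⟩ := mem_layerP hx'
    have := two_le_card_diff hm hm'
    rw [ip_lvec]; push_cast; omega
  · obtain ⟨m, hm, rfl⟩ := mem_layerP hx
    obtain ⟨m', hm', rfl⟩ := mem_layerM hx'
    have := two_le_card_diff hm' hm
    rw [ip_lvec, show ham14 m ^^^ 3 ^^^ ham14 m' = ham14 m' ^^^ (ham14 m ^^^ 3) from Nat.xor_comm _ _]
    push_cast; omega
  · obtain ⟨m, hm, rfl⟩ := mem_layerP hx
    obtain ⟨m', hm', rfl⟩ := mem_layerP hx'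
    have hmm : m ≠ m' := fun h => hne (by rw [h])
    have := four_le_card_diff hm hm' hmm
    rw [ip_lvec, show ham14 m ^^^ 3 ^^^ (ham14 m' ^^^ 3) = ham14 m ^^^ ham14 m' by
      rw [Nat.xor_assoc, Nat.xor_left_comm 3, Nat.xor_self, Nat.xor_zero]]
    push_cast; omega

/-- Layer against outer: `≤ 8`. -/
theorem ip_layer_outer {x z : Fin 24 → ℤ} (hx : x ∈ layerM ∨ x ∈ layerP) (hz : z ∈ outer) : ip x z ≤ 8 := by
  rw [outer] at hz
  obtain ⟨⟨i, a, b, t⟩, -, rfl⟩ := mem_image.mp hz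
  have key : ∀ (c : ℕ) (e : ℤ), e = 1 ∨ e = -1 →
      ip (lvec c e) (pvec {(⟨2 * i.val, by omega⟩ : Fin 24), ⟨2 * i.val + 1, by omega⟩}
        (fun j => if j.val = 2 * i.val then a else b) 2 (2 * sgn t)) ≤ 8 := by
    intro c e he
    have h := ip_pvec_pvec_le_inter cells14_sub (sub_cells_of_lt14 (pair_lt14 i)) (fun j => c.testBit j.val)
      (fun j => if j.val = 2 * i.val then a else b) (by norm_num : (0 : ℤ) ≤ 1 * 2) e (2 * sgn t)
    have hle : ((cells14 ∩ {(⟨2 * i.val, by omega⟩ : Fin 24), ⟨2 * i.val + 1, by omega⟩}).card : ℤ) ≤ 2 := by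
      exact_mod_cast (card_le_card inter_subset_right).trans (by rw [card_pair (by simp)])
    rw [lvec]
    rcases he with rfl | rfl <;> rcases sgn_cases t with h1 | h1 <;> rw [h1] at h ⊢ <;> push_cast at h ⊢ <;> linarith
  rcases hx with hx | hx
  · obtain ⟨m, -, rfl⟩ := mem_layerM hx
    exact key _ _ (Or.inr rfl)
  · obtain ⟨m, -, rfl⟩ := mem_layerP hx
    exact key _ _ (Or.inl rfl)

/-- Outer against outer: `≤ 8`. -/
theorem ip_outer_outer {x x' : Fin 24 → ℤ} (hx : x ∈ outer) (hx' : x' ∈ outer) (hne : x ≠ x') : ip x x' ≤ 8 := by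
  rw [outer] at hx hx'
  obtain ⟨⟨i, a, b, t⟩, -, rfl⟩ := mem_image.mp hx
  obtain ⟨⟨i', a', b', t'⟩, -, rfl⟩ := mem_image.mp hx'
  simp only at hne ⊢
  set S : Finset (Fin 24) := {(⟨2 * i.val, by omega⟩ : Fin 24), ⟨2 * i.val + 1, by omega⟩} with hSdef
  set S' : Finset (Fin 24) := {(⟨2 * i'.val, by omega⟩ : Fin 24), ⟨2 * i'.val + 1, by omega⟩} with hS'def
  have hS := sub_cells_of_lt14 (pair_lt14 i)
  have hS' := sub_cells_of_lt14 (pair_lt14 i')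
  have hcard : S.card = 2 := card_pair (by simp)
  by_cases hii : i = i'
  · subst hii
    by_cases htt : t = t'
    · subst htt
      -- same pair, same axis: the patterns differ
      have hne2 : ∃ j ∈ S, (fun j : Fin 24 => if j.val = 2 * i.val then a else b) j ≠
          (fun j : Fin 24 => if j.val = 2 * i.val then a' else b') j := by
        by_contra hall
        push Not at hall
        exact hne (pvec_congr hall 2 (2 * sgn t))
      obtain ⟨j, hj, hfj⟩ := hne2
      rw [ip_pvec_pvec hS hS, Finset.inter_self, hcard]
      have hpos : (1 : ℤ) ≤ ((S.filter fun j => ((fun j : Fin 24 => if j.val = 2 * i.val then a else b) j ^^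
          (fun j : Fin 24 => if j.val = 2 * i.val then a' else b') j) = true).card : ℤ) := by
        have : 0 < (S.filter fun j => ((fun j : Fin 24 => if j.val = 2 * i.val then a else b) j ^^
            (fun j : Fin 24 => if j.val = 2 * i.val then a' else b') j) = true).card := by
          apply Finset.card_pos.mpr
          refine ⟨j, Finset.mem_filter.mpr ⟨hj, ?_⟩⟩
          revert hfj
          cases (fun j : Fin 24 => if j.val = 2 * i.val then a else b) j <;>
            cases (fun j : Fin 24 => if j.val = 2 * i.val then a' else b') j <;> simp
        exact_mod_cast this
      push_cast at hpos ⊢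
      rcases sgn_cases t with h1 | h1 <;> rw [h1] <;> nlinarith [hpos]
    · have h := ip_pvec_pvec_le_inter hS hS (fun j : Fin 24 => if j.val = 2 * i.val then a else b)
        (fun j : Fin 24 => if j.val = 2 * i.val then a' else b') (by norm_num : (0 : ℤ) ≤ 2 * 2)
        (2 * sgn t) (2 * sgn t')
      rw [Finset.inter_self, hcard] at h
      have hs : sgn t * sgn t' = -1 := by revert htt; cases t <;> cases t' <;> simp
      have e2 : (2 : ℤ) * (2 * sgn t) * (2 * sgn t') = 8 * (sgn t * sgn t') := by ring
      rw [e2, hs] at h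
      push_cast at h ⊢
      linarith
  · have h := ip_pvec_pvec_le_inter hS hS' (fun j : Fin 24 => if j.val = 2 * i.val then a else b)
      (fun j : Fin 24 => if j.val = 2 * i'.val then a' else b') (by norm_num : (0 : ℤ) ≤ 2 * 2)
      (2 * sgn t) (2 * sgn t')
    have h0 : S ∩ S' = ∅ := by
      rw [hSdef, hS'def]
      ext j
      simp only [Finset.mem_inter, Finset.mem_insert, Finset.mem_singleton, Finset.notMem_empty, iff_false,
        not_and, Fin.ext_iff]
      have : i.val ≠ i'.val := fun h => hii (Fin.ext h)
      omega
    rw [h0, Finset.card_empty] at h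
    push_cast at h
    rcases sgn_cases t with h1 | h1 <;> rcases sgn_cases t' with h2 | h2 <;> rw [h1, h2] at h ⊢ <;> linarith

/-- **All pairwise inner products of distinct vectors of `P₁₅ₐ` are `≤ 8`** (half the norm). -/
theorem ip_le_of_mem_p15a {x x' : Fin 24 → ℤ} (hx : x ∈ p15a) (hx' : x' ∈ p15a) (hne : x ≠ x') : ip x x' ≤ 8 := by
  rw [p15a, mem_union, mem_union, mem_union] at hx hx'
  rcases hx with ((hx | hx) | hx) | hx <;> rcases hx' with ((hx' | hx') | hx') | hx'
  · exact ip_central_central hx hx' hne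
  · exact ip_central_le hx (Or.inl hx')
  · exact ip_central_le hx (Or.inr (Or.inl hx'))
  · exact ip_central_le hx (Or.inr (Or.inr hx'))
  · rw [ip_comm]; exact ip_central_le hx' (Or.inl hx)
  · exact ip_layer_layer (Or.inl hx) (Or.inl hx') hne
  · exact ip_layer_layer (Or.inl hx) (Or.inr hx') hne
  · exact ip_layer_outer (Or.inl hx) hx'
  · rw [ip_comm]; exact ip_central_le hx' (Or.inr (Or.inl hx))
  · exact ip_layer_layer (Or.inr hx) (Or.inl hx') hne
  · exact ip_layer_layer (Or.inr hx) (Or.inr hx') hne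
  · exact ip_layer_outer (Or.inr hx) hx'
  · rw [ip_comm]; exact ip_central_le hx' (Or.inr (Or.inr hx))
  · rw [ip_comm]; exact ip_layer_outer (Or.inl hx') hx
  · rw [ip_comm]; exact ip_layer_outer (Or.inr hx') hx
  · exact ip_outer_outer hx hx' hne

/-! ### The nine integer normals and the transfer to `ℝ¹⁵` -/

/-- Normals of `{y₁₄ = y₁₅ = 0, y₁₆ = y₁₇, y₁₈ = ⋯ = y₂₃ = 0}`: `e₁₆ − e₁₇`, `e₁₄`, `e₁₅`, `e₁₈, …, e₂₃`. -/
def nu15 (i : Fin 9) (j : Fin 24) : ℤ :=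
  if i.val = 0 then (if j.val = 16 then 1 else if j.val = 17 then -1 else 0)
  else if i.val ≤ 2 then (if j.val = 13 + i.val then 1 else 0)
  else if j.val = 15 + i.val then 1 else 0

/-- Kernel facts: pairwise orthogonal, nonzero, vanishing on cells `< 14`, annihilating the `√2`-axis. -/
theorem nu15_facts : (∀ i i' : Fin 9, i ≠ i' → ip (nu15 i) (nu15 i') = 0) ∧ (∀ i : Fin 9, ip (nu15 i) (nu15 i) ≠ 0) ∧
    (∀ i : Fin 9, (∀ j : Fin 24, j.val < 14 → nu15 i j = 0) ∧ nu15 i 16 + nu15 i 17 = 0) := by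
  refine ⟨by decide, by decide, by decide⟩

/-- A normal annihilates every vector of `P₁₅ₐ`. -/
theorem ip_nu15_of_mem {x : Fin 24 → ℤ} (hx : x ∈ p15a) (i : Fin 9) : ip (nu15 i) x = 0 := by
  obtain ⟨c, S, f, a, e, hS, rfl, -⟩ := exists_pvec_of_mem_p15a hx
  obtain ⟨hcell, h16⟩ := nu15_facts.2.2 i
  have h0 : ip (nu15 i) (pvec S f a e) = 0 := by
    rw [ip_pvec]
    rw [Finset.sum_eq_zero fun j hj => by rw [hcell j (hS j hj), zero_mul]]
    linear_combination e * h16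
  simp only [ip, Pi.smul_apply, smul_eq_mul] at h0 ⊢
  rw [show ∑ j, nu15 i j * (c * pvec S f a e j) = c * ∑ j, nu15 i j * pvec S f a e j by
    rw [Finset.mul_sum]; exact Finset.sum_congr rfl fun j _ => by ring, h0, mul_zero]

/-- **The configuration `P₁₅ₐ`**, normalised, inside `ℝ²⁴`. [cite: ConwaySloane1999, Ch. 5 §4.3] -/
noncomputable def p15aE : Finset (EuclideanSpace ℝ (Fin 24)) := p15a.image (toE 16)

/-- The normals as vectors of `ℝ²⁴`. -/
noncomputable def nrm15 (i : Fin 9) : EuclideanSpace ℝ (Fin 24) := toE 1 (nu15 i)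

/-- The normals are linearly independent. -/
theorem linearIndependent_nrm15 : LinearIndependent ℝ nrm15 := by
  obtain ⟨horth, hnz, -⟩ := nu15_facts
  apply linearIndependent_of_ne_zero_of_inner_eq_zero
  · intro i h
    have h1 : inner ℝ (nrm15 i) (nrm15 i) = 0 := by rw [h, inner_zero_left]
    rw [nrm15, inner_toE (by norm_num), div_eq_zero_iff] at h1
    rcases h1 with h1 | h1
    · exact hnz i (by exact_mod_cast h1)
    · norm_num at h1
  · intro i j hij
    rw [nrm15, nrm15, inner_toE (by norm_num), horth i j hij]
    simp

/-- **`κ(15) ≥ 2564`** (Leech–Sloane's `P₁₅ₐ`): a kissing configuration of `2564` unit vectors in `ℝ¹⁵`.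
[cite: ConwaySloane1999, Table 1.2] -/
theorem exists_kissing_2564 : ∃ C : Finset (EuclideanSpace ℝ (Fin 15)),
    C.card = 2564 ∧ (∀ x ∈ C, ‖x‖ = 1) ∧ (∀ x ∈ C, ∀ y ∈ C, x ≠ y → inner ℝ x y ≤ 1 / 2) := by
  have hc : p15aE.card = 2564 := by
    rw [p15aE, card_image_of_injective _ (toE_injective (by norm_num)), card_p15a]
  have hn : ∀ p ∈ p15aE, ‖p‖ = 1 := by
    intro p hp
    obtain ⟨x, hx, rfl⟩ := mem_image.mp hp
    obtain ⟨-, -, -, -, -, -, -, h16⟩ := exists_pvec_of_mem_p15a hx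
    exact norm_toE (by norm_num) (by rw [h16]; norm_num)
  have hi : ∀ p ∈ p15aE, ∀ q ∈ p15aE, p ≠ q → inner ℝ p q ≤ 1 / 2 := by
    intro p hp q hq hpq
    obtain ⟨x, hx, rfl⟩ := mem_image.mp hp
    obtain ⟨y, hy, rfl⟩ := mem_image.mp hq
    rw [inner_toE (by norm_num), div_le_iff₀ (by norm_num)]
    have h : (ip x y : ℝ) ≤ 8 := by exact_mod_cast ip_le_of_mem_p15a hx hy (fun h => hpq (by rw [h]))
    linarith
  have ho : ∀ p ∈ p15aE, ∀ i, inner ℝ (nrm15 i) p = 0 := by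
    intro p hp i
    obtain ⟨x, hx, rfl⟩ := mem_image.mp hp
    rw [nrm15, inner_toE_toE (by norm_num) (by norm_num), ip_nu15_of_mem hx i]
    simp
  obtain ⟨C', hc', hno, hi', _⟩ := exists_transfer_orthogonal (m := 24) (n := 15) (k := 9) (by norm_num)
    nrm15 linearIndependent_nrm15 p15aE ho
  refine ⟨C', by rw [hc', hc], fun x' hx' => ?_, fun x' hx' y' hy' hne => ?_⟩
  · obtain ⟨x, hx, he⟩ := hno x' hx'
    rw [he]; exact hn x hx
  · obtain ⟨x, hx, y, hy, hxy, he⟩ := hi' x' hx' y' hy' hne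
    rw [he]; exact hi x hx y hy hxy

/-- **`2564 ≤ κ(15) ≤ 5431` in Lean** (explicit `P₁₅ₐ`; Delsarte LP certificate of the cell). -/
theorem kissing_dim15_bracket :
    (∃ C : Finset (EuclideanSpace ℝ (Fin 15)), C.card = 2564 ∧ (∀ x ∈ C, ‖x‖ = 1) ∧
      (∀ x ∈ C, ∀ y ∈ C, x ≠ y → inner ℝ x y ≤ 1 / 2)) ∧
    ∀ C : Finset (EuclideanSpace ℝ (Fin 15)), (∀ x ∈ C, ‖x‖ = 1) →
      (∀ x ∈ C, ∀ y ∈ C, x ≠ y → inner ℝ x y ≤ 1 / 2) → C.card ≤ 5431 :=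
  ⟨exists_kissing_2564, Kissing.kissing_dim15_le_5431⟩

end Summit.Ventures.PackingBounds.Config.ConsA
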